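import Summits.CriticalPhenomena.SAWScalingLimit.Theorems.HexConjecture.Negative.LoadBearing
import Literature.Probability.LatticeModels.TriangularLatticeProofs
import Literature.Probability.RandomPlanarGeometry.HexDomainSingleton
import Literature.Probability.Percolation.CanonicalDiscretisationTies
import Summits.CriticalPhenomena.SAWScalingLimit.Theorems.ObservableToSLE.Negative.Identification

/-!
# `HexConjecture` — non-vacuity of its hypothesis on the honeycomb lattice

Support file for crux `stmt-CriticalPhenomena-0808` (cdisprove): the unit disc `(𝔻; 1, -1)` carries
a hexagonal endpoint approximation `IsEmbEndpointApprox hexGraph hexCenter 𝔻 aIn bIn`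
(`isEmbEndpointApprox_unitDisc`). Engine: the honeycomb mesh graph of a disc centred at the origin
is connected (descent of `Q = A² + AB + B² = 9‖hexCenter‖²` to the central hexagon), so `Ω_δ` is
the whole mesh (`embMeshDomain_ball_eq`) and reachability is membership.

Consequences (EXISTENCE DEBT of the crux, no named facts): `exists_isSLECurve_unitDisc_of_hexConjecture`
— any proof of `HexConjecture` produces a chordal SLE_{8/3} random curve in the unit disc, an
instance of the unproved named fact `exists_isSLECurve`; `isProbabilityMeasure_preWiener_of_hexConjecture`
— it also forces `preWienerMeasure univ = 1`. Also `IsEmbEndpointApprox.eventually_ne`.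
-/

noncomputable section

namespace Summit.CriticalPhenomena.SAWScalingLimit.Cruxes.HexConjecture.NonVacuity

open MeasureTheory Filter Topology Set
open Literature.Probability.LatticeModels Literature.Probability.RandomPlanarGeometry
open Literature.Probability.RandomPlanarGeometry.SAW
open scoped NNReal ENNReal
open Summit.CriticalPhenomena.SAWScalingLimit.Cruxes.HexConjecture.Negative

section NonVacuity

/-- `A = 3x₀ + t + 1` for the face `(x; t)`. [folklore] -/
def qA (v : HexVertex) : ℤ := 3 * v.1 0 + (v.2 : ℕ) + 1
/-- `B = 3x₁ + t + 1` for the face `(x; t)`. [folklore] -/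
def qB (v : HexVertex) : ℤ := 3 * v.1 1 + (v.2 : ℕ) + 1
/-- The integer quadratic form `Q(v) = A² + AB + B² = 9 ‖hexCenter v‖²`. [folklore] -/
def qf (v : HexVertex) : ℤ := qA v ^ 2 + qA v * qB v + qB v ^ 2

/-- Real part of a face centre, in coordinates. [folklore] -/
theorem hexCenter_re_eq (v : HexVertex) :
    (hexCenter v).re = (v.1 0 : ℝ) + (v.1 1 : ℝ) / 2 + (((v.2 : ℕ) : ℝ) + 1) / 2 := by
  obtain ⟨x, t⟩ := v
  simp [hexCenter, triEmbed, triZeta_re, triZeta_im]; ring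

/-- Imaginary part of a face centre, in coordinates. [folklore] -/
theorem hexCenter_im_eq (v : HexVertex) :
    (hexCenter v).im = ((v.1 1 : ℝ) + (((v.2 : ℕ) : ℝ) + 1) / 3) * (Real.sqrt 3 / 2) := by
  obtain ⟨x, t⟩ := v
  simp [hexCenter, triEmbed, triZeta_re, triZeta_im]; ring

/-- `9 ‖hexCenter v‖² = Q(v)`. [folklore] -/
theorem nine_mul_norm_sq (v : HexVertex) : 9 * ‖hexCenter v‖ ^ 2 = (qf v : ℝ) := by
  rw [← Complex.normSq_eq_norm_sq, Complex.normSq_apply, hexCenter_re_eq, hexCenter_im_eq]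
  have h3 : Real.sqrt 3 * Real.sqrt 3 = 3 := Real.mul_self_sqrt (by norm_num)
  simp only [qf, qA, qB]
  push_cast
  linear_combination (9 / 4 : ℝ) * ((v.1 1 : ℝ) + (((v.2 : ℕ) : ℝ) + 1) / 3) ^ 2 * h3

/-- `Q < Q'` iff the centre is strictly closer to the origin. [folklore] -/
theorem norm_lt_norm_of_qf_lt {v w : HexVertex} (h : qf w < qf v) : ‖hexCenter w‖ < ‖hexCenter v‖ := by
  have h' : (qf w : ℝ) < qf v := by exact_mod_cast h
  rw [← nine_mul_norm_sq, ← nine_mul_norm_sq] at h'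
  exact lt_of_pow_lt_pow_left₀ 2 (norm_nonneg _) (by linarith)

/-- Elementary inequality: `A ≤ 1`, `B ≤ 1`, `A + B ≥ -1` force `A² + AB + B² ≤ 3`. [folklore] -/
theorem qform_le_three {A B : ℤ} (h1 : -1 ≤ A + B) (h2 : A ≤ 1) (h3 : B ≤ 1) :
    A ^ 2 + A * B + B ^ 2 ≤ 3 := by
  nlinarith [mul_nonneg (sub_nonneg.2 h2) (sub_nonneg.2 h3),
    mul_nonneg (by linarith : (0 : ℤ) ≤ A + B + 1) (sub_nonneg.2 h2),
    mul_nonneg (by linarith : (0 : ℤ) ≤ A + B + 1) (sub_nonneg.2 h3)]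

/-- **Descent.** Every face with `Q ≥ 4` has a honeycomb neighbour strictly closer to the origin:
for an up-face the three moves change `Q` by `3A + 3B + 3`, `-3A + 3`, `-3B + 3`, which cannot all be
`≥ 0` unless `Q ≤ 3` (`qform_le_three`); symmetrically for down-faces. [folklore] -/
theorem exists_adj_qf_lt (v : HexVertex) (hv : 4 ≤ qf v) : ∃ w, hexGraph.Adj v w ∧ qf w < qf v := by
  obtain ⟨x, t⟩ := v
  obtain ⟨a, b, rfl⟩ : ∃ a b : ℤ, x = ![a, b] := ⟨x 0, x 1, by funext j; fin_cases j <;> rfl⟩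
  by_contra hcon
  push Not at hcon
  fin_cases t
  · have h1 := hcon (![a, b], 1) (hexGraph_adj_up a b)
    have h2 := hcon (![a - 1, b], 1) (by simpa using (hexGraph_adj_e0 (a - 1) b).symm)
    have h3 := hcon (![a, b - 1], 1) (hexGraph_adj_dn a b)
    simp [qf, qA, qB] at h1 h2 h3 hv
    have key := qform_le_three (A := 3 * a + 1) (B := 3 * b + 1) (by nlinarith) (by nlinarith) (by nlinarith)
    nlinarith
  · have h1 := hcon (![a, b], 0) (hexGraph_adj_up a b).symm
    have h2 := hcon (![a + 1, b], 0) (hexGraph_adj_e0 a b)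
    have h3 := hcon (![a, b + 1], 0) (hexGraph_adj_e1 a b)
    simp [qf, qA, qB] at h1 h2 h3 hv
    have key := qform_le_three (A := -(3 * a + 2)) (B := -(3 * b + 2)) (by nlinarith) (by nlinarith)
      (by nlinarith)
    nlinarith

/-- The six faces around the origin (the central hexagon of the honeycomb lattice). [folklore] -/
def IsCentral (v : HexVertex) : Prop :=
  v = (![0, 0], 0) ∨ v = (![-1, 0], 1) ∨ v = (![-1, 0], 0) ∨ v = (![-1, -1], 1) ∨
    v = (![0, -1], 0) ∨ v = (![0, -1], 1)

/-- `Q ≤ 3` only on the central hexagon. [folklore] -/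
theorem isCentral_of_qf_le (v : HexVertex) (h : qf v ≤ 3) : IsCentral v := by
  obtain ⟨x, t⟩ := v
  obtain ⟨a, b, rfl⟩ : ∃ a b : ℤ, x = ![a, b] := ⟨x 0, x 1, by funext j; fin_cases j <;> rfl⟩
  unfold IsCentral
  fin_cases t
  · simp [qf, qA, qB] at h
    have ha : -1 ≤ a ∧ a ≤ 0 := by constructor <;> nlinarith [sq_nonneg (2 * (3 * b + 1) + (3 * a + 1))]
    have hb : -1 ≤ b ∧ b ≤ 0 := by constructor <;> nlinarith [sq_nonneg (2 * (3 * a + 1) + (3 * b + 1))]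
    obtain ⟨ha1, ha2⟩ := ha
    obtain ⟨hb1, hb2⟩ := hb
    interval_cases a <;> interval_cases b <;> first | (norm_num at h; done) | simp
  · simp [qf, qA, qB] at h
    have ha : -1 ≤ a ∧ a ≤ 0 := by constructor <;> nlinarith [sq_nonneg (2 * (3 * b + 2) + (3 * a + 2))]
    have hb : -1 ≤ b ∧ b ≤ 0 := by constructor <;> nlinarith [sq_nonneg (2 * (3 * a + 2) + (3 * b + 2))]
    obtain ⟨ha1, ha2⟩ := ha
    obtain ⟨hb1, hb2⟩ := hb
    interval_cases a <;> interval_cases b <;> first | (norm_num at h; done) | simp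

/-- Central faces have `Q = 3`, i.e. `‖hexCenter‖ = 1/√3 < 1`. [folklore] -/
theorem qf_eq_three_of_isCentral {v : HexVertex} (h : IsCentral v) : qf v = 3 := by
  rcases h with rfl | rfl | rfl | rfl | rfl | rfl <;> simp [qf, qA, qB]

/-- Central faces have norm `< 1`. [folklore] -/
theorem norm_lt_one_of_isCentral {v : HexVertex} (h : IsCentral v) : ‖hexCenter v‖ < 1 := by
  have h9 := nine_mul_norm_sq v
  rw [qf_eq_three_of_isCentral h] at h9
  have : ‖hexCenter v‖ ^ 2 < 1 := by push_cast at h9; nlinarith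
  exact (pow_lt_one_iff_of_nonneg (norm_nonneg _) two_ne_zero).1 this

variable {δ : ℝ}

/-- The honeycomb mesh vertex set of the unit disc. -/
abbrev meshBall (δ : ℝ) : Set HexVertex := embMeshVertices hexCenter (Metric.ball (0 : ℂ) 1) δ

/-- The honeycomb mesh graph of the unit disc, induced on its vertex set. -/
abbrev meshBallGraph (δ : ℝ) : SimpleGraph (meshBall δ) :=
  embMeshVertexGraph hexGraph hexCenter (Metric.ball (0 : ℂ) 1) δ

/-- Membership in the mesh vertex set of the disc is `δ ‖hexCenter v‖ < 1`. [folklore] -/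
theorem mem_meshBall_iff (hδ : 0 < δ) {v : HexVertex} : v ∈ meshBall δ ↔ δ * ‖hexCenter v‖ < 1 := by
  rw [mem_embMeshVertices_iff, Metric.mem_ball, dist_zero_right, norm_mul, Complex.norm_real,
    Real.norm_eq_abs, abs_of_pos hδ]

/-- Central faces are mesh vertices of the disc for `δ < 1`. [folklore] -/
theorem mem_meshBall_of_isCentral (hδ : 0 < δ) (hδ1 : δ < 1) {v : HexVertex} (h : IsCentral v) :
    v ∈ meshBall δ :=
  (mem_meshBall_iff hδ).2 (mul_lt_one_of_nonneg_of_lt_one_left hδ.le hδ1 (norm_lt_one_of_isCentral h).le)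

/-- A closer face is a mesh vertex if the farther one is. [folklore] -/
theorem mem_meshBall_of_qf_lt (hδ : 0 < δ) {v w : HexVertex} (hv : v ∈ meshBall δ) (h : qf w < qf v) :
    w ∈ meshBall δ := by
  rw [mem_meshBall_iff hδ] at hv ⊢
  exact lt_of_le_of_lt (mul_le_mul_of_nonneg_left (norm_lt_norm_of_qf_lt h).le hδ.le) hv

/-- Honeycomb neighbours inside the disc are mesh-graph neighbours (the disc is convex, so the
rescaled segment stays in the closed disc). [folklore] -/
theorem meshBallGraph_adj (u w : meshBall δ) (hadj : hexGraph.Adj u.1 w.1) : (meshBallGraph δ).Adj u w := by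
  rw [SimpleGraph.induce_adj, embMeshGraph_adj_iff]
  exact ⟨hadj, ((convex_ball (0 : ℂ) 1).segment_subset u.2 w.2).trans subset_closure⟩

/-- Descent to the central hexagon inside the mesh graph of the disc. [folklore] -/
theorem exists_isCentral_reachable (hδ : 0 < δ) (u : meshBall δ) :
    ∃ c : meshBall δ, IsCentral c.1 ∧ (meshBallGraph δ).Reachable u c := by
  obtain ⟨n, hn⟩ : ∃ n : ℕ, qf u.1 ≤ n := ⟨(qf u.1).toNat, Int.self_le_toNat _⟩
  induction n generalizing u with
  | zero => exact ⟨u, isCentral_of_qf_le _ (by omega), SimpleGraph.Reachable.refl _⟩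
  | succ n ih =>
    by_cases h3 : qf u.1 ≤ 3
    · exact ⟨u, isCentral_of_qf_le _ h3, SimpleGraph.Reachable.refl _⟩
    · obtain ⟨w, hadj, hlt⟩ := exists_adj_qf_lt u.1 (by omega)
      have hw : w ∈ meshBall δ := mem_meshBall_of_qf_lt hδ u.2 hlt
      obtain ⟨c, hc, hr⟩ := ih ⟨w, hw⟩ (by push_cast at hn ⊢; omega)
      exact ⟨c, hc, (meshBallGraph_adj u ⟨w, hw⟩ hadj).reachable.trans hr⟩

/-- The root vertex `(0,0;0)` of the central hexagon, as a mesh vertex (`δ < 1`). -/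
def root (hδ : 0 < δ) (hδ1 : δ < 1) : meshBall δ :=
  ⟨(![0, 0], 0), mem_meshBall_of_isCentral hδ hδ1 (Or.inl rfl)⟩

/-- Every central face is joined to the root along the central hexagon
`(0,0;0) – (-1,0;1) – (-1,0;0) – (-1,-1;1) – (0,-1;0) – (0,-1;1) – (0,0;0)`. [folklore] -/
theorem reachable_root_of_isCentral (hδ : 0 < δ) (hδ1 : δ < 1) (c : meshBall δ) (hc : IsCentral c.1) :
    (meshBallGraph δ).Reachable c (root hδ hδ1) := by
  -- the six central mesh vertices
  have m1 := mem_meshBall_of_isCentral hδ hδ1 (Or.inr (Or.inl rfl) : IsCentral (![-1, 0], 1))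
  have m2 := mem_meshBall_of_isCentral hδ hδ1 (Or.inr (Or.inr (Or.inl rfl)) : IsCentral (![-1, 0], 0))
  have m3 := mem_meshBall_of_isCentral hδ hδ1
    (Or.inr (Or.inr (Or.inr (Or.inl rfl))) : IsCentral (![-1, -1], 1))
  have m4 := mem_meshBall_of_isCentral hδ hδ1
    (Or.inr (Or.inr (Or.inr (Or.inr (Or.inl rfl)))) : IsCentral (![0, -1], 0))
  have m5 := mem_meshBall_of_isCentral hδ hδ1
    (Or.inr (Or.inr (Or.inr (Or.inr (Or.inr rfl)))) : IsCentral (![0, -1], 1))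
  -- the edges of the hexagon we use, oriented towards the root
  have e10 : (meshBallGraph δ).Reachable ⟨(![-1, 0], 1), m1⟩ (root hδ hδ1) :=
    (meshBallGraph_adj _ _ (by simpa [root] using hexGraph_adj_e0 (-1) 0)).reachable
  have e21 : (meshBallGraph δ).Reachable ⟨(![-1, 0], 0), m2⟩ ⟨(![-1, 0], 1), m1⟩ :=
    (meshBallGraph_adj _ _ (hexGraph_adj_up (-1) 0)).reachable
  have e32 : (meshBallGraph δ).Reachable ⟨(![-1, -1], 1), m3⟩ ⟨(![-1, 0], 0), m2⟩ :=
    (meshBallGraph_adj _ _ (by simpa using (hexGraph_adj_dn (-1) 0).symm)).reachable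
  have e50 : (meshBallGraph δ).Reachable ⟨(![0, -1], 1), m5⟩ (root hδ hδ1) :=
    (meshBallGraph_adj _ _ (by simpa [root] using hexGraph_adj_e1 0 (-1))).reachable
  have e45 : (meshBallGraph δ).Reachable ⟨(![0, -1], 0), m4⟩ ⟨(![0, -1], 1), m5⟩ :=
    (meshBallGraph_adj _ _ (hexGraph_adj_up 0 (-1))).reachable
  obtain ⟨c, hcm⟩ := c
  rcases hc with h | h | h | h | h | h <;> subst h
  · exact SimpleGraph.Reachable.refl _
  · exact e10
  · exact e21.trans e10
  · exact e32.trans (e21.trans e10)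
  · exact e45.trans e50
  · exact e50

/-- **The honeycomb mesh graph of the unit disc is connected** (`0 < δ < 1`). [folklore] -/
theorem meshBallGraph_reachable (hδ : 0 < δ) (hδ1 : δ < 1) (u w : meshBall δ) :
    (meshBallGraph δ).Reachable u w := by
  obtain ⟨c, hc, hr⟩ := exists_isCentral_reachable hδ u
  obtain ⟨c', hc', hr'⟩ := exists_isCentral_reachable hδ w
  exact (hr.trans (reachable_root_of_isCentral hδ hδ1 c hc)).trans
    (hr'.trans (reachable_root_of_isCentral hδ hδ1 c' hc')).symm

/-- Hence the discrete domain `Ω_δ` of the unit disc is the WHOLE mesh (one component). [folklore] -/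
theorem embMeshDomain_ball_eq (hδ : 0 < δ) (hδ1 : δ < 1) :
    embMeshDomain hexGraph hexCenter (Metric.ball (0 : ℂ) 1) δ = meshBall δ := by
  refine (embMeshDomain_subset _ _ _ _).antisymm fun v hv => ?_
  simp only [embMeshDomain, Set.mem_iUnion, Set.mem_image]
  refine ⟨(meshBallGraph δ).connectedComponentMk ⟨v, hv⟩, fun C' => ?_, ⟨v, hv⟩, rfl, rfl⟩
  induction C' using SimpleGraph.ConnectedComponent.ind with
  | h u =>
    rw [SimpleGraph.ConnectedComponent.sound (meshBallGraph_reachable hδ hδ1 u ⟨v, hv⟩)]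

/-- … and reachability in `Ω_δ` is just membership in the disc (`0 < δ < 1`). [folklore] -/
theorem hexDomainGraph_ball_reachable (hδ : 0 < δ) (hδ1 : δ < 1) {u w : HexVertex}
    (hu : u ∈ meshBall δ) (hw : w ∈ meshBall δ) :
    (hexDomainGraph (Metric.ball (0 : ℂ) 1) δ).Reachable u w := by
  let φ : meshBallGraph δ →g hexDomainGraph (Metric.ball (0 : ℂ) 1) δ :=
    { toFun := Subtype.val
      map_rel' := fun {a b} h => (embDomainGraph_adj_iff hexGraph hexCenter).2
        ⟨SimpleGraph.induce_adj.1 h, (embMeshDomain_ball_eq hδ hδ1).symm ▸ a.2,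
          (embMeshDomain_ball_eq hδ hδ1).symm ▸ b.2⟩ }
  exact (meshBallGraph_reachable hδ hδ1 ⟨u, hu⟩ ⟨w, hw⟩).map φ

/-- Lattice points approaching `+1` from INSIDE the disc: `δ · centre = δ(⌈δ⁻¹⌉₊ - 5/2) + iδ√3/6`. -/
def aIn (δ : ℝ) : HexVertex := vOut ((⌈δ⁻¹⌉₊ : ℤ) - 3)

/-- Lattice points approaching `-1` from INSIDE the disc. -/
def bIn (δ : ℝ) : HexVertex := vOut (-(⌈δ⁻¹⌉₊ : ℤ) + 2)

/-- `δ · centre(aIn δ)` in coordinates. [folklore] -/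
theorem smul_hexCenter_aIn (δ : ℝ) :
    (δ : ℂ) * hexCenter (aIn δ) =
      ((δ * (⌈δ⁻¹⌉₊ : ℝ) - δ * (5 / 2) : ℝ) : ℂ) + ((δ * (Real.sqrt 3 / 6) : ℝ) : ℂ) * Complex.I := by
  rw [aIn, hexCenter_vOut]; push_cast; ring

/-- `δ · centre(bIn δ)` in coordinates. [folklore] -/
theorem smul_hexCenter_bIn (δ : ℝ) :
    (δ : ℂ) * hexCenter (bIn δ) =
      ((-(δ * (⌈δ⁻¹⌉₊ : ℝ) - δ * (5 / 2)) : ℝ) : ℂ) + ((δ * (Real.sqrt 3 / 6) : ℝ) : ℂ) * Complex.I := by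
  rw [bIn, hexCenter_vOut]; push_cast; ring

/-- `δ · centre(aIn δ) → 1`. [folklore] -/
theorem tendsto_aIn : Tendsto (fun δ : ℝ => (δ : ℂ) * hexCenter (aIn δ)) (𝓝[>] (0 : ℝ)) (𝓝 1) := by
  have h0 : Tendsto (fun δ : ℝ => δ) (𝓝[>] (0 : ℝ)) (𝓝 0) :=
    tendsto_nhdsWithin_of_tendsto_nhds tendsto_id
  have h1 : Tendsto (fun δ : ℝ => δ * (⌈δ⁻¹⌉₊ : ℝ) - δ * (5 / 2)) (𝓝[>] (0 : ℝ)) (𝓝 1) := by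
    simpa using tendsto_mul_natCeil_inv.sub (h0.mul_const (5 / 2 : ℝ))
  have h2 : Tendsto (fun δ : ℝ => δ * (Real.sqrt 3 / 6)) (𝓝[>] (0 : ℝ)) (𝓝 0) := by
    simpa using h0.mul_const (Real.sqrt 3 / 6 : ℝ)
  have h3 := ((Complex.continuous_ofReal.tendsto 1).comp h1).add
    (((Complex.continuous_ofReal.tendsto 0).comp h2).mul_const Complex.I)
  simp only [Function.comp_def, Complex.ofReal_one, Complex.ofReal_zero, zero_mul, add_zero] at h3
  refine h3.congr' (Eventually.of_forall fun δ => ?_)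
  beta_reduce
  rw [smul_hexCenter_aIn]

/-- `δ · centre(bIn δ) → -1`. [folklore] -/
theorem tendsto_bIn : Tendsto (fun δ : ℝ => (δ : ℂ) * hexCenter (bIn δ)) (𝓝[>] (0 : ℝ)) (𝓝 (-1)) := by
  have h0 : Tendsto (fun δ : ℝ => δ) (𝓝[>] (0 : ℝ)) (𝓝 0) :=
    tendsto_nhdsWithin_of_tendsto_nhds tendsto_id
  have h1 : Tendsto (fun δ : ℝ => -(δ * (⌈δ⁻¹⌉₊ : ℝ) - δ * (5 / 2))) (𝓝[>] (0 : ℝ)) (𝓝 (-1)) := by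
    simpa using (tendsto_mul_natCeil_inv.sub (h0.mul_const (5 / 2 : ℝ))).neg
  have h2 : Tendsto (fun δ : ℝ => δ * (Real.sqrt 3 / 6)) (𝓝[>] (0 : ℝ)) (𝓝 0) := by
    simpa using h0.mul_const (Real.sqrt 3 / 6 : ℝ)
  have h3 := ((Complex.continuous_ofReal.tendsto (-1)).comp h1).add
    (((Complex.continuous_ofReal.tendsto 0).comp h2).mul_const Complex.I)
  simp only [Function.comp_def, Complex.ofReal_neg, Complex.ofReal_one, Complex.ofReal_zero,
    zero_mul, add_zero] at h3
  refine h3.congr' (Eventually.of_forall fun δ => ?_)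
  beta_reduce
  rw [smul_hexCenter_bIn]; push_cast; ring

/-- The key estimate: for `0 < δ < 2/5`, `(δ⌈δ⁻¹⌉₊ - 5δ/2)² + δ²/12 < 1`. [folklore] -/
theorem radius_estimate (hδ : 0 < δ) (hδ2 : δ < 2 / 5) :
    (δ * (⌈δ⁻¹⌉₊ : ℝ) - δ * (5 / 2)) ^ 2 + (δ * (Real.sqrt 3 / 6)) ^ 2 < 1 := by
  have h3 : Real.sqrt 3 ^ 2 = 3 := Real.sq_sqrt (by norm_num)
  have hc1 : 1 ≤ δ * (⌈δ⁻¹⌉₊ : ℝ) := one_le_mul_natCeil_inv hδ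
  have hc2 : δ * (⌈δ⁻¹⌉₊ : ℝ) < 1 + δ := by
    have := Nat.ceil_lt_add_one (inv_nonneg.2 hδ.le)
    calc δ * (⌈δ⁻¹⌉₊ : ℝ) < δ * (δ⁻¹ + 1) := by gcongr
      _ = 1 + δ := by field_simp
  set r := δ * (⌈δ⁻¹⌉₊ : ℝ) - δ * (5 / 2) with hr
  have hr0 : 0 < r := by rw [hr]; linarith
  have hr1 : r < 1 - δ * (3 / 2) := by rw [hr]; linarith
  have hrr : r ^ 2 < (1 - δ * (3 / 2)) ^ 2 := by nlinarith
  have h36 : (δ * (Real.sqrt 3 / 6)) ^ 2 = δ ^ 2 / 12 := by rw [mul_pow, div_pow, h3]; ring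
  rw [h36]
  nlinarith

/-- `aIn δ` is a mesh vertex of the disc for `0 < δ < 2/5`. [folklore] -/
theorem aIn_mem (hδ : 0 < δ) (hδ2 : δ < 2 / 5) : aIn δ ∈ meshBall δ := by
  rw [mem_embMeshVertices_iff, Metric.mem_ball, dist_zero_right,
    ← pow_lt_one_iff_of_nonneg (norm_nonneg _) two_ne_zero, ← Complex.normSq_eq_norm_sq,
    smul_hexCenter_aIn, Complex.normSq_apply]
  simpa [sq] using radius_estimate hδ hδ2

/-- `bIn δ` is a mesh vertex of the disc for `0 < δ < 2/5`. [folklore] -/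
theorem bIn_mem (hδ : 0 < δ) (hδ2 : δ < 2 / 5) : bIn δ ∈ meshBall δ := by
  rw [mem_embMeshVertices_iff, Metric.mem_ball, dist_zero_right,
    ← pow_lt_one_iff_of_nonneg (norm_nonneg _) two_ne_zero, ← Complex.normSq_eq_norm_sq,
    smul_hexCenter_bIn, Complex.normSq_apply]
  have := radius_estimate hδ hδ2
  simp only [Complex.add_re, Complex.ofReal_re, Complex.mul_re, Complex.I_re, mul_zero,
    Complex.ofReal_im, Complex.I_im, sub_zero, add_zero, Complex.add_im, Complex.mul_im,
    mul_one, zero_add]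
  nlinarith [this]

/-- **NON-VACUITY of the crux's hypothesis**: `(aIn, bIn)` is an endpoint approximation of the
Dobrushin domain `(𝔻; 1, -1)` on the honeycomb lattice. [folklore] -/
theorem isEmbEndpointApprox_unitDisc :
    IsEmbEndpointApprox hexGraph hexCenter DobrushinDomain.unitDisc aIn bIn where
  reachable := by
    filter_upwards [Ioo_mem_nhdsGT (show (0 : ℝ) < 2 / 5 by norm_num)] with δ hδ
    exact hexDomainGraph_ball_reachable hδ.1 (by linarith [hδ.2]) (aIn_mem hδ.1 hδ.2)
      (bIn_mem hδ.1 hδ.2)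
  tendsto_fst := by rw [Literature.Probability.Percolation.unitDisc_pt_zero]; exact tendsto_aIn
  tendsto_snd := by rw [unitDisc_pt_one]; exact tendsto_bIn

end NonVacuity

/-! ### Consequences: existence debt of the crux -/

section Debt

open Literature.Probability.Process

/-- **Endpoint approximations have eventually DISTINCT endpoints** (the two marked points of a
Dobrushin domain are distinct and both rescaled endpoints converge). [folklore] -/
theorem IsEmbEndpointApprox.eventually_ne {D : DobrushinDomain} {a b : ℝ → HexVertex}
    (h : IsEmbEndpointApprox hexGraph hexCenter D a b) : ∀ᶠ δ in 𝓝[>] (0 : ℝ), a δ ≠ b δ := by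
  have hne : D.pt 0 ≠ D.pt 1 := by
    intro heq
    have h01 : D.mark 0 = D.mark 1 := D.injOn_boundary (D.mark_mem 0) (D.mark_mem 1) heq
    exact absurd h01 (D.strictMono_mark (show (0 : Fin 2) < 1 by decide)).ne
  obtain ⟨U, V, hU, hV, hxU, hyV, hUV⟩ := t2_separation hne
  filter_upwards [h.tendsto_fst.eventually (hU.mem_nhds hxU),
    h.tendsto_snd.eventually (hV.mem_nhds hyV)] with δ ha hb
  intro heq
  rw [heq] at ha
  exact Set.disjoint_iff.1 hUV ⟨ha, hb⟩

-- buildfix 2026-08-19 (ops-buildfix lane): route SAWDefectDecoherence DROPPED its decl `HexConjecture` (rev 17) and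
-- inlined the body into its crux; the three hypotheses below now name the byte-identical decl
-- `Theses.SAWDevelopingMap.HexConjecture` (DCS 2012 Conj. 1 as typed; in the import closure via
-- `ObservableToSLE.Negative.Identification`). Same proposition, same proofs.

/-- **Existence debt, general form.** The crux, applied to one Dobrushin domain carrying an
endpoint approximation, yields a chordal SLE_{8/3} random curve there. [folklore] -/
theorem exists_isSLECurve_of_hexConjecture (h : Theses.SAWDevelopingMap.HexConjecture)
    {D : DobrushinDomain} {a b : ℝ → HexVertex} (happ : IsEmbEndpointApprox hexGraph hexCenter D a b) :
    ∃ Γ, IsSLECurve ((8 : ℝ≥0) / 3) D Γ := by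
  obtain ⟨Γ, hΓ, -, -⟩ := h D a b happ
  exact ⟨Γ, hΓ⟩

/-- **Existence debt, unconditional form**: the crux proves the existence of a chordal SLE_{8/3}
random curve in the unit disc — an instance of the UNPROVED named fact `exists_isSLECurve`
(`κ = 8/3`, `D = 𝔻`): trace existence (Rohde–Schramm), transience, Carathéodory. [folklore] -/
theorem exists_isSLECurve_unitDisc_of_hexConjecture (h : Theses.SAWDevelopingMap.HexConjecture) :
    ∃ Γ, IsSLECurve ((8 : ℝ≥0) / 3) DobrushinDomain.unitDisc Γ :=
  exists_isSLECurve_of_hexConjecture h isEmbEndpointApprox_unitDisc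

/-- **Existence debt, II**: the crux forces `preWienerMeasure univ = 1`, i.e. it decides the `dif`
in `Process.projectiveLimit` the way the Kolmogorov-extension fact
`isProjectiveLimit_preWienerMeasure` does. No named fact is used. [folklore] -/
theorem isProbabilityMeasure_preWiener_of_hexConjecture (h : Theses.SAWDevelopingMap.HexConjecture) :
    IsProbabilityMeasure preWienerMeasure := by
  obtain ⟨Γ, -, -, hlaw⟩ := h DobrushinDomain.unitDisc aIn bIn isEmbEndpointApprox_unitDisc
  exact isProbabilityMeasure_preWiener_of_tendstoLaw
    (Theorems.ObservableToSLE.Negative.eventually_isProbabilityMeasure_hexSAWLaw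
      isEmbEndpointApprox_unitDisc) hlaw

end Debt

end Summit.CriticalPhenomena.SAWScalingLimit.Cruxes.HexConjecture.NonVacuity
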